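import Literature.NumberTheory.Sieve.BDHVarianceLowerBound
import Literature.NumberTheory.LFunctions.DirichletFamilyLowZeroSpacing
import Literature.NumberTheory.LFunctions.Zhang2022.TypedSection01and02A
import Literature.NumberTheory.LFunctions.SubnormalZetaGapsOffLine

/-!
# Route `PrimeLevelFamEdge` — TYPED IDEA DELTAS, deck 5: the cell's two SECOND DOORS onto the same
# rung leaf (off G-24): K-I1-1 ★ «variance floor» (RS-var) and K-I3-2 / R-19 «family sub-half gaps»
(cell ls-idea; both ride census rows R-19 / RS-var, not the U-d clause; they serve the route's rung
leaf `Zhang2022.Skeleton.LOneLowerBound A` ⊇ `Theorem1`, hence the same target as `FamEdgeWeightTwo`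
one door over — filed `--supports stmt-Parity-20004 --as helper` and SAID SO)

PROOF-FREE `def … : Prop` deltas over landed Literature vocabulary (`BDHVariance.bdhVariance`,
`harperSoundararajan2017_theorem1`; `DirichletFamilyZeroSpacing.FamilySubHalfGaps`). The two
«criteria» (door ⇒ leaf) are UNPRINTED implications typed AS PROPS (idea objects to be proved, not
facts); NOTHING IS ASSERTED. «typed ≠ proved; no exceptional-zero theorem (no Landau–Siegel exclusion,
no Theorem 1–2 of arXiv:2211.02515, no repaired Margin232) is proved by ideation». Cards / verdicts:
`run/shared/lean/pub/ls-idea/cards/ls-idea-lens-1.md` (K-I1-1 ★, §2.6, §7 RS-var; sketch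
`Sketch_VarianceFloor.lean`), `cards/ls-idea-lens-3.md` (K-I3-2), `CARDS.md` §1b.
-/

noncomputable section

namespace Summit.Parity.GeneralizedHardyLittlewood.Theorems.PrimeLevelFamEdgeIdeaDeltas

open Literature.NumberTheory.Sieve Literature.NumberTheory.LFunctions

/-! ## §1 K-I1-1 ★ «HALF-LATTICE FORM FACTOR / VARIANCE FLOOR» — door RS-var (lens-1; critics A PASS
as SECOND DOOR · B PASS ★ (priced) · C PASS, novelty pending acq-11684) -/

/-- **K-I1-1 ★ door `X_var` = RS-var «minor-arc variance of the primes» (lens-1).** Mechanism (card):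
in the (A)-world the q-family of all primitive characters to conductor `≍ Q = D^A` sees the
exceptional zero as a HALF-LATTICE form factor — the prime variance in progressions is suppressed to
its MAJOR-ARC value on scales attached to the zero; the printed UNCONDITIONAL floor is
Harper–Soundararajan 2017 Thm 1, `V(x,Q) ≥ (1−ε) Q x (log(Q²/x) − C log log x)` for `√x ≤ Q ≤ x`
(tree: `harperSoundararajan2017_theorem1`, BDHVarianceLowerBound.lean), i.e. the constant `1` in front
of `x^{1+θ}(2θ−1) log x` at `Q = x^θ`. THE DOOR: beat that constant by `c > 0` at ONE level
`Q = x^θ`, `θ ∈ (3/4, 1)` — «primes are not hyper-uniform in progressions beyond the major arcs» —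
for all large `x` (lens-1 §7: `V(x, x^θ) ≥ (1+c)·x^{1+θ}·(2θ−1)·log x`). Controls: proposed REQSIDE
row RS-var (desk → ls-rescue-lead 18:01Z (b)); off-G-24 second door (variance-currency re-typing of
the R-19 family door). Why novel (card; critic C): CLLR 2014 is GRH-only and never evaluates the
exceptional world; HS17/FG96 give the floor, nobody states «floor + ε ⇒ no Siegel zero». Falsifier
(card): the (A)-world model computation of `V` on attached scales (is the suppression exactly to the
HS constant?); clock crux R (K-I1-3) and off-line bookkeeping Z are the two NAMED cruxes of the
reduction, not typed here. A PREDICATE in `(θ, c)`; nothing asserted; typed ≠ proved.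
[cite: HarperSoundararajan2017, Thm. 1] -/
def VarianceFloorBeyondMajorArcs (θ c : ℝ) : Prop :=
  ∃ x₀ : ℕ, ∀ x : ℕ, x₀ ≤ x →
    (1 + c) * (x : ℝ) ^ (1 + θ) * (2 * θ - 1) * Real.log x ≤
      BDHVariance.bdhVariance (x : ℝ) ⌊(x : ℝ) ^ θ⌋₊

/-- **The UNPRINTED criterion of door RS-var as a Prop** («X_var ⇒ rung leaf»): a variance floor
beyond the major arcs at one `θ ∈ (3/4,1)` with some `c > 0` implies the effective lower bound
`L(1,χ) > c₁(log D)^{−A}` for all real primitive `χ` (`Zhang2022.Skeleton.LOneLowerBound A`, the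
ladder currency). The card's reduction runs «door → clock crux R (K-I1-3, q-aspect Conrey–Iwaniec
Prop 10.1) → off-line crux Z (Huxley density) → leaf»; none of it is printed as a theorem — this is
the SHAPE a proof would have to establish, NOT asserted. [cite: HarperSoundararajan2017, Thm. 1 (the anchor only)]
[cite: ConreyIwaniec2002, Prop. 10.1 (the clock mechanism of crux R)] -/
def VarianceDoorCriterion (θ c : ℝ) (A : ℕ) : Prop :=
  VarianceFloorBeyondMajorArcs θ c → Zhang2022.Skeleton.LOneLowerBound A

/-- Bookkeeping (proved): the door is monotone in the gain — beating the constant by `c` beats it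
by every `c' ≤ c` (for `θ > ½`, where `2θ − 1 > 0`, and `x ≥ 1`). [cite: HarperSoundararajan2017, Thm. 1] -/
theorem VarianceFloorBeyondMajorArcs.anti {θ c c' : ℝ} (hθ : 1 / 2 < θ) (hc : c' ≤ c)
    (h : VarianceFloorBeyondMajorArcs θ c) : VarianceFloorBeyondMajorArcs θ c' := by
  obtain ⟨x₀, hx⟩ := h
  refine ⟨max x₀ 1, fun x hx' ↦ le_trans ?_ (hx x (le_trans (le_max_left _ _) hx'))⟩
  have hx1 : (1 : ℝ) ≤ x := by exact_mod_cast le_trans (le_max_right _ _) hx'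
  have hpow : 0 ≤ (x : ℝ) ^ (1 + θ) := Real.rpow_nonneg (by linarith) _
  have hlog : 0 ≤ Real.log x := Real.log_nonneg hx1
  have h2θ : 0 ≤ 2 * θ - 1 := by linarith
  have : 0 ≤ (x : ℝ) ^ (1 + θ) * (2 * θ - 1) * Real.log x := by positivity
  nlinarith

/-! ## §2 K-I3-2 «TWIST-FAMILY ZERO SPACING, DE-GRH'D» / census R-19 TOP SEED — the F6-twin
criterion as a Prop (lens-3; critics A PASS (F6-twin, two cruxes flagged) · B FIX answered · C
PASS-with-FIX; desk: «zero-spacing predicates» priority) -/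

/-- **K-I3-2 / R-19: the UNPRINTED family criterion as a Prop** («family sub-half gaps with density
⇒ effective `L(1,χ) ≫ (log q)^{−A}`»): the twist-family twin of Conrey–Iwaniec's Thm 1.1/1.2 (tree
facts `conreyIwaniec2002_theorem11/12`, whose consumer Prop 10.1 allows zeros off the line), with the
family objects of `DirichletFamilyZeroSpacing` — radius factor `μ < ½`, density `dens` an explicit
PARAMETER (print fixes none: CIS 2012 give ONE pair per dyadic range under GRH, `μ₁ = 0.366`;
`familySubHalfGaps_inv_sq_iff`). The card's two cruxes: K1 = this consumer transplanted to
`L(s,χ)L(s,χχ_D)` (not in print: «loosely speaking … see [CI]»), K2 = its de-GRH'd supply by mean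
squares. The SHAPE a proof would have to establish; NOT asserted; typed ≠ proved.
[cite: ConreyIwaniec2002, Thm. 1.2 (the ζ-instance of the shape)] [cite: ConreyIwaniecSoundararajan2012, §1 p. 3] -/
def FamilySubHalfGapsCriterion (μ : ℝ) (dens : ℝ → ℝ) (A : ℕ) : Prop :=
  DirichletFamilyZeroSpacing.FamilySubHalfGaps μ dens → Zhang2022.Skeleton.LOneLowerBound A

/-- Bookkeeping (proved): the criterion is monotone in the exponent of the conclusion (a criterion
giving `(log D)^{−A}` gives `(log D)^{−A'}` for every `A' ≥ A`, by the tree's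
`Zhang2022.Section1.lOneLowerBound_mono`). [cite: ConreyIwaniec2002, Thm. 1.2] -/
theorem FamilySubHalfGapsCriterion.mono {μ : ℝ} {dens : ℝ → ℝ} {A A' : ℕ} (hAA' : A ≤ A')
    (h : FamilySubHalfGapsCriterion μ dens A) : FamilySubHalfGapsCriterion μ dens A' :=
  fun hX ↦ Zhang2022.Section1.lOneLowerBound_mono hAA' (h hX)

/-! ## §3 K6-7 «MIRROR PAIRS» — the CI-GAPS door with OFF-LINE zeros admitted: Conrey–Iwaniec's
AUTHOR-ASSERTED off-line extension as an OWNED criterion Prop (lens-6 gen 1; critic A PASS as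
REQUIREMENT-LEDGER with the ownership flag «`…prop101_offline` must be an OWNED crux, never a
cite-tagged fact»; B seat closed; C pending). Objects and proved bookkeeping (ℂ-pairs, mirror lemma,
collar inclusion, `H ⇒ H^ℂ`) are the Literature file `SubnormalZetaGapsOffLine.lean` (p563869). -/

/-- **K6-7: the UNPRINTED off-line CI-GAPS criterion as a Prop** («`H^ℂ(κ, α)` ⇒ effective
`L(1,χ) ≫ (log q)^{−E}` for ODD real primitive `χ`», the conclusion shape of `conreyIwaniec2002_theorem12`
/ `ciGaps_door` with a general exponent `E`). Conrey–Iwaniec STATE WITHOUT PROOF (p. 3 L40–L47) that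
their method accepts pairs of zeros «which may or may not be on the critical line»; card K6-7 reads off
that (i) near-off-line zeros then supply pairs for free via their functional-equation MIRRORS
(`hasCloseZeroC_of_offline_zero`, `collarZeroOrdinates_subset_closeZeroOrdinatesC` — PROVED), so
(ii) an RH-free detector may count ordinate-clusters of ALL zeros and assume «critical or
collar-exterior» w.l.o.g. This Prop is the SHAPE such a theorem would have — the card's OWNED CRUX
(the off-line Prop 10.1 carried through CI §§7–10 with `e^{O(1)}` losses inside the collar; the
card's reading check: `|x(s)| = 2 log tQ · sinh(|η|L)/(|η|L) ≥ 2 log tQ` for mirror pairs, Cor 7.6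
with `α = 1`), NOT a fact of the tree and NOT asserted. Controls: GAP-TABLE Part F F6, both readings;
replaces the M–O input «RH» by «functional equation + off-line Prop 10.1». Falsifiers (card): F1 carry
`s_r = β_r + it_r` through CI §§8–9; F2 the dichotomy is only as useful as a bound on collar-EXTERIOR
zeros. A PREDICATE in `(κ, α, E)`; typed ≠ proved.
[cite: ConreyIwaniec2002, Thm. 1.2 and p. 3 L40–L47 (extension asserted, not proved)] -/
def OffLineGapsCriterion (κ α E : ℝ) : Prop :=
  SubnormalGapsHypothesisC κ α →
    ∃ c' : ℝ, 0 < c' ∧ ∀ (q : ℕ) [NeZero q], 4 < q → ∀ χ : DirichletCharacter ℂ q,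
      χ.IsPrimitive → χ.IsQuadratic → χ.Odd → c' * Real.log q ^ (-E) ≤ ‖χ.LFunction 1‖

/-- Bookkeeping (proved): an off-line criterion at `(κ, α, E)` contains the CRITICAL-pairs criterion
at the same parameters, because `H(κ, α) ⇒ H^ℂ(κ, α)` (`SubnormalGapsHypothesisKappa.toOffLine`) —
admitting off-line zeros can only make the door easier to open and the criterion harder to prove.
[cite: ConreyIwaniec2002, Thm. 1.2] -/
theorem OffLineGapsCriterion.of_kappa {κ α E : ℝ} (h : OffLineGapsCriterion κ α E)
    (hX : SubnormalGapsHypothesisKappa κ α) :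
    ∃ c' : ℝ, 0 < c' ∧ ∀ (q : ℕ) [NeZero q], 4 < q → ∀ χ : DirichletCharacter ℂ q,
      χ.IsPrimitive → χ.IsQuadratic → χ.Odd → c' * Real.log q ^ (-E) ≤ ‖χ.LFunction 1‖ :=
  h hX.toOffLine

/-- Bookkeeping (proved): the criterion is monotone in the exponent of the conclusion — `(log q)^{−E'}
≤ (log q)^{−E}` for `E ≤ E'` and `q ≥ 3` (`log q ≥ 1`). [cite: ConreyIwaniec2002, Thm. 1.2] -/
theorem OffLineGapsCriterion.mono {κ α E E' : ℝ} (hEE : E ≤ E') (h : OffLineGapsCriterion κ α E) :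
    OffLineGapsCriterion κ α E' := by
  intro hX
  obtain ⟨c', hc', H⟩ := h hX
  refine ⟨c', hc', fun q _ hq χ hprim hquad hodd ↦ le_trans ?_ (H q hq χ hprim hquad hodd)⟩
  have hq3 : (3 : ℝ) ≤ q := by exact_mod_cast (show 3 ≤ q by omega)
  have hlog : 1 ≤ Real.log q := by
    rw [← Real.log_exp 1]
    exact Real.log_le_log (Real.exp_pos 1) (le_trans (by linarith [Real.exp_one_lt_d9]) hq3)
  exact mul_le_mul_of_nonneg_left (Real.rpow_le_rpow_of_exponent_le hlog (by linarith)) hc'.le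

end Summit.Parity.GeneralizedHardyLittlewood.Theorems.PrimeLevelFamEdgeIdeaDeltas
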